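import Mathlib
import HarnessLib
import Summits.KontsevichZagierPeriods.KontsevichZagierPeriods.Theorems.FurushoPentagonKernelModuloPeriodConjectureLeafWeightNineNFA
import Summits.KontsevichZagierPeriods.KontsevichZagierPeriods.Theorems.FurushoPentagonKernelModuloPeriodConjectureLeafWeightNineNFB
import Summits.KontsevichZagierPeriods.KontsevichZagierPeriods.Theorems.FurushoPentagonKernelModuloPeriodConjectureLeafWeightNineNFC
import Summits.KontsevichZagierPeriods.KontsevichZagierPeriods.Theorems.FurushoPentagonKernelModuloPeriodConjectureLeafWeightNineNFD
import Summits.KontsevichZagierPeriods.KontsevichZagierPeriods.Theorems.FurushoPentagonKernelModuloPeriodConjectureLeafWeightNineNFE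
import Summits.KontsevichZagierPeriods.KontsevichZagierPeriods.Theorems.FurushoPentagonKernelModuloPeriodConjectureLeafWeightNineNFF
import Summits.KontsevichZagierPeriods.KontsevichZagierPeriods.Theorems.FurushoPentagonKernelModuloPeriodConjectureLeafWeightNineNFG
import Summits.KontsevichZagierPeriods.KontsevichZagierPeriods.Theorems.FurushoPentagonKernelModuloPeriodConjectureLeafWeightNineNFH
import Summits.KontsevichZagierPeriods.KontsevichZagierPeriods.Theorems.FurushoPentagonKernelModuloPeriodConjectureLeafWeightNineNFI
import Summits.KontsevichZagierPeriods.KontsevichZagierPeriods.Theorems.FurushoPentagonKernelModuloPeriodConjectureLeafWeightNineNFJ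
import Summits.KontsevichZagierPeriods.KontsevichZagierPeriods.Theorems.FurushoPentagonKernelModuloPeriodConjectureLeafWeightNineNFK
import Summits.KontsevichZagierPeriods.KontsevichZagierPeriods.Theorems.FurushoPentagonKernelModuloPeriodConjectureLeafWeightNineNFL
import Summits.KontsevichZagierPeriods.KontsevichZagierPeriods.Theorems.FurushoPentagonKernelModuloPeriodConjectureLeafWeightNineNFM
import Summits.KontsevichZagierPeriods.KontsevichZagierPeriods.Theorems.FurushoPentagonKernelModuloPeriodConjectureLeafWeightNineNFN
import Summits.KontsevichZagierPeriods.KontsevichZagierPeriods.Theorems.FurushoPentagonKernelModuloPeriodConjectureLeafWeightNineNFO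
import Summits.KontsevichZagierPeriods.KontsevichZagierPeriods.Theorems.FurushoPentagonKernelModuloPeriodConjectureLeafWeightNineNFP
import Summits.KontsevichZagierPeriods.KontsevichZagierPeriods.Theorems.FurushoPentagonKernelModuloPeriodConjectureLeafWeightNineNFQ
import Summits.KontsevichZagierPeriods.KontsevichZagierPeriods.Theorems.FurushoPentagonKernelModuloPeriodConjectureLeafWeightNineNFR
import Summits.KontsevichZagierPeriods.KontsevichZagierPeriods.Theorems.FurushoPentagonKernelModuloPeriodConjectureLeafWeightNineNFS
import Summits.KontsevichZagierPeriods.KontsevichZagierPeriods.Theorems.FurushoPentagonKernelModuloPeriodConjectureLeafLowWeight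

/-!
# `KernelModuloPeriodConjecture`, line `Sketch`: the algebraic leaf in weight 9

Part: per-depth dispatch to the certificates.

Crux `FurushoPentagon.KernelModuloPeriodConjecture` (stmt-KontsevichZagierPeriods-15058), line
`Sketch`, registered stub `stub_leafWeightNine` — generated part file of the weight-`9` Hoffman
reduction for abstract group-like pentagon solutions (method, row families and references: module
docstring of `Theorems/FurushoPentagonKernelModuloPeriodConjectureLeafWeightNine.lean`; rows =
`x₁`-shuffle regularisation, duality `DrinfeldPentagon.apply_reverse_map_not`, Furusho's double
shuffle `DrinfeldPentagon.piY_mul_piY_eq_sum_stuffle`; certificates = exact rational linear algebra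
checked by `linear_combination`).

References: [IharaKanekoZagier2006] §2; [Furusho2011] Thm 1.2, §5; [Furusho2010] Lemma 6.
-/

namespace Summit.KontsevichZagierPeriods.FurushoPentagon.KernelModuloPeriodConjecture

open Literature.NumberTheory.Transcendental
open MZV (binaryWord)

/-- The weight-`9` leaf in depth `1`: dispatch of the admissible indices `[n1]` of weight `9` to
their certificates (`interval_cases` with `omega` pruning). [cite: IharaKanekoZagier2006, §2] -/
theorem leafW9_depth1 (n1 : ℕ) (hn1 : 2 ≤ n1)  (hw : n1 = 9) :
    ∃ b : List ℕ →₀ ℚ, (∀ t ∈ b.support, MZV.IsHoffman t ∧ MZV.weight t = MZV.weight [n1]) ∧ ∀ (R :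
      Type) [CommRing R] [Algebra ℚ R] [IsReduced R] (φ : NCSeries Bool R), NCSeries.IsGroupLike φ →
      NCSeries.DrinfeldPentagon φ → φ (MZV.binaryWord [n1]) = b.sum (fun t q => q • φ
      (MZV.binaryWord t)) := by
  obtain rfl : n1 = 9 := by omega
  exact leafCert_w9_9

/-- The weight-`9` leaf in depth `2`: dispatch of the admissible indices `[n1, n2]` of weight `9` to
their certificates (`interval_cases` with `omega` pruning). [cite: IharaKanekoZagier2006, §2] -/
theorem leafW9_depth2 (n1 : ℕ) (n2 : ℕ) (hn1 : 2 ≤ n1) (hn2 : 1 ≤ n2) (hw : n1 + n2 = 9) :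
    ∃ b : List ℕ →₀ ℚ, (∀ t ∈ b.support, MZV.IsHoffman t ∧ MZV.weight t = MZV.weight [n1, n2]) ∧ ∀
      (R : Type) [CommRing R] [Algebra ℚ R] [IsReduced R] (φ : NCSeries Bool R),
      NCSeries.IsGroupLike φ → NCSeries.DrinfeldPentagon φ → φ (MZV.binaryWord [n1, n2]) = b.sum
      (fun t q => q • φ (MZV.binaryWord t)) := by
  have hn1' : n1 ≤ 8 := by omega
  have hn2' : n2 ≤ 7 := by omega
  interval_cases n1 <;>
    interval_cases n2 <;>
    first
    | omega
    | exact leafLowWeight_of_isHoffman (by decide)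
    | exact leafCert_w9_27
    | exact leafCert_w9_36
    | exact leafCert_w9_45
    | exact leafCert_w9_54
    | exact leafCert_w9_63
    | exact leafCert_w9_72
    | exact leafCert_w9_81

/-- The weight-`9` leaf in depth `3`: dispatch of the admissible indices `[n1, n2, n3]` of weight
`9` to their certificates (`interval_cases` with `omega` pruning). [cite: IharaKanekoZagier2006, §2]
-/
theorem leafW9_depth3 (n1 : ℕ) (n2 : ℕ) (n3 : ℕ) (hn1 : 2 ≤ n1) (hn2 : 1 ≤ n2) (hn3 : 1 ≤ n3) (hw :
    n1 + (n2 + n3) = 9) :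
    ∃ b : List ℕ →₀ ℚ, (∀ t ∈ b.support, MZV.IsHoffman t ∧ MZV.weight t = MZV.weight [n1, n2, n3]) ∧
      ∀ (R : Type) [CommRing R] [Algebra ℚ R] [IsReduced R] (φ : NCSeries Bool R),
      NCSeries.IsGroupLike φ → NCSeries.DrinfeldPentagon φ → φ (MZV.binaryWord [n1, n2, n3]) = b.sum
      (fun t q => q • φ (MZV.binaryWord t)) := by
  have hn1' : n1 ≤ 7 := by omega
  have hn2' : n2 ≤ 6 := by omega
  have hn3' : n3 ≤ 6 := by omega
  interval_cases n1 <;>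
    interval_cases n2 <;> (try (exfalso; omega)) <;>
    interval_cases n3 <;>
    first
    | omega
    | exact leafLowWeight_of_isHoffman (by decide)
    | exact leafCert_w9_216
    | exact leafCert_w9_225
    | exact leafCert_w9_234
    | exact leafCert_w9_243
    | exact leafCert_w9_252
    | exact leafCert_w9_261
    | exact leafCert_w9_315
    | exact leafCert_w9_324
    | exact leafCert_w9_342
    | exact leafCert_w9_351
    | exact leafCert_w9_414
    | exact leafCert_w9_423
    | exact leafCert_w9_432
    | exact leafCert_w9_441
    | exact leafCert_w9_513
    | exact leafCert_w9_522
    | exact leafCert_w9_531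
    | exact leafCert_w9_612
    | exact leafCert_w9_621
    | exact leafCert_w9_711

/-- The weight-`9` leaf in depth `4`: dispatch of the admissible indices `[n1, n2, n3, n4]` of
weight `9` to their certificates (`interval_cases` with `omega` pruning). [cite:
IharaKanekoZagier2006, §2] -/
theorem leafW9_depth4 (n1 : ℕ) (n2 : ℕ) (n3 : ℕ) (n4 : ℕ) (hn1 : 2 ≤ n1) (hn2 : 1 ≤ n2) (hn3 : 1 ≤
    n3) (hn4 : 1 ≤ n4) (hw : n1 + (n2 + (n3 + n4)) = 9) :
    ∃ b : List ℕ →₀ ℚ, (∀ t ∈ b.support, MZV.IsHoffman t ∧ MZV.weight t = MZV.weight [n1, n2, n3,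
      n4]) ∧ ∀ (R : Type) [CommRing R] [Algebra ℚ R] [IsReduced R] (φ : NCSeries Bool R),
      NCSeries.IsGroupLike φ → NCSeries.DrinfeldPentagon φ → φ (MZV.binaryWord [n1, n2, n3, n4]) =
      b.sum (fun t q => q • φ (MZV.binaryWord t)) := by
  have hn1' : n1 ≤ 6 := by omega
  have hn2' : n2 ≤ 5 := by omega
  have hn3' : n3 ≤ 5 := by omega
  have hn4' : n4 ≤ 5 := by omega
  interval_cases n1 <;>
    interval_cases n2 <;> (try (exfalso; omega)) <;>
    interval_cases n3 <;> (try (exfalso; omega)) <;>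
    interval_cases n4 <;>
    first
    | omega
    | exact leafLowWeight_of_isHoffman (by decide)
    | exact leafCert_w9_2115
    | exact leafCert_w9_2124
    | exact leafCert_w9_2133
    | exact leafCert_w9_2142
    | exact leafCert_w9_2151
    | exact leafCert_w9_2214
    | exact leafCert_w9_2241
    | exact leafCert_w9_2313
    | exact leafCert_w9_2331
    | exact leafCert_w9_2412
    | exact leafCert_w9_2421
    | exact leafCert_w9_2511
    | exact leafCert_w9_3114
    | exact leafCert_w9_3123
    | exact leafCert_w9_3132
    | exact leafCert_w9_3141
    | exact leafCert_w9_3213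
    | exact leafCert_w9_3231
    | exact leafCert_w9_3312
    | exact leafCert_w9_3321
    | exact leafCert_w9_3411
    | exact leafCert_w9_4113
    | exact leafCert_w9_4122
    | exact leafCert_w9_4131
    | exact leafCert_w9_4212
    | exact leafCert_w9_4221
    | exact leafCert_w9_4311
    | exact leafCert_w9_5112
    | exact leafCert_w9_5121
    | exact leafCert_w9_5211
    | exact leafCert_w9_6111

/-- The weight-`9` leaf in depth `5`: dispatch of the admissible indices `[n1, n2, n3, n4, n5]` of
weight `9` to their certificates (`interval_cases` with `omega` pruning). [cite:
IharaKanekoZagier2006, §2] -/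
theorem leafW9_depth5 (n1 : ℕ) (n2 : ℕ) (n3 : ℕ) (n4 : ℕ) (n5 : ℕ) (hn1 : 2 ≤ n1) (hn2 : 1 ≤ n2)
    (hn3 : 1 ≤ n3) (hn4 : 1 ≤ n4) (hn5 : 1 ≤ n5) (hw : n1 + (n2 + (n3 + (n4 + n5))) = 9) :
    ∃ b : List ℕ →₀ ℚ, (∀ t ∈ b.support, MZV.IsHoffman t ∧ MZV.weight t = MZV.weight [n1, n2, n3,
      n4, n5]) ∧ ∀ (R : Type) [CommRing R] [Algebra ℚ R] [IsReduced R] (φ : NCSeries Bool R),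
      NCSeries.IsGroupLike φ → NCSeries.DrinfeldPentagon φ → φ (MZV.binaryWord [n1, n2, n3, n4, n5])
      = b.sum (fun t q => q • φ (MZV.binaryWord t)) := by
  have hn1' : n1 ≤ 5 := by omega
  have hn2' : n2 ≤ 4 := by omega
  have hn3' : n3 ≤ 4 := by omega
  have hn4' : n4 ≤ 4 := by omega
  have hn5' : n5 ≤ 4 := by omega
  interval_cases n1 <;>
    interval_cases n2 <;> (try (exfalso; omega)) <;>
    interval_cases n3 <;> (try (exfalso; omega)) <;>
    interval_cases n4 <;> (try (exfalso; omega)) <;>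
    interval_cases n5 <;>
    first
    | omega
    | exact leafLowWeight_of_isHoffman (by decide)
    | exact leafCert_w9_21114
    | exact leafCert_w9_21123
    | exact leafCert_w9_21132
    | exact leafCert_w9_21141
    | exact leafCert_w9_21213
    | exact leafCert_w9_21222
    | exact leafCert_w9_21231
    | exact leafCert_w9_21312
    | exact leafCert_w9_21321
    | exact leafCert_w9_21411
    | exact leafCert_w9_22113
    | exact leafCert_w9_22122
    | exact leafCert_w9_22131
    | exact leafCert_w9_22212
    | exact leafCert_w9_22221
    | exact leafCert_w9_22311
    | exact leafCert_w9_23112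
    | exact leafCert_w9_23121
    | exact leafCert_w9_23211
    | exact leafCert_w9_24111
    | exact leafCert_w9_31113
    | exact leafCert_w9_31122
    | exact leafCert_w9_31131
    | exact leafCert_w9_31212
    | exact leafCert_w9_31221
    | exact leafCert_w9_31311
    | exact leafCert_w9_32112
    | exact leafCert_w9_32121
    | exact leafCert_w9_32211
    | exact leafCert_w9_33111
    | exact leafCert_w9_41112
    | exact leafCert_w9_41121
    | exact leafCert_w9_41211
    | exact leafCert_w9_42111
    | exact leafCert_w9_51111

/-- The weight-`9` leaf in depth `6`: dispatch of the admissible indices `[n1, n2, n3, n4, n5, n6]`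
of weight `9` to their certificates (`interval_cases` with `omega` pruning). [cite:
IharaKanekoZagier2006, §2] -/
theorem leafW9_depth6 (n1 : ℕ) (n2 : ℕ) (n3 : ℕ) (n4 : ℕ) (n5 : ℕ) (n6 : ℕ) (hn1 : 2 ≤ n1) (hn2 : 1
    ≤ n2) (hn3 : 1 ≤ n3) (hn4 : 1 ≤ n4) (hn5 : 1 ≤ n5) (hn6 : 1 ≤ n6) (hw : n1 + (n2 + (n3 + (n4 +
    (n5 + n6)))) = 9) :
    ∃ b : List ℕ →₀ ℚ, (∀ t ∈ b.support, MZV.IsHoffman t ∧ MZV.weight t = MZV.weight [n1, n2, n3,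
      n4, n5, n6]) ∧ ∀ (R : Type) [CommRing R] [Algebra ℚ R] [IsReduced R] (φ : NCSeries Bool R),
      NCSeries.IsGroupLike φ → NCSeries.DrinfeldPentagon φ → φ (MZV.binaryWord [n1, n2, n3, n4, n5,
      n6]) = b.sum (fun t q => q • φ (MZV.binaryWord t)) := by
  have hn1' : n1 ≤ 4 := by omega
  have hn2' : n2 ≤ 3 := by omega
  have hn3' : n3 ≤ 3 := by omega
  have hn4' : n4 ≤ 3 := by omega
  have hn5' : n5 ≤ 3 := by omega
  have hn6' : n6 ≤ 3 := by omega
  interval_cases n1 <;>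
    interval_cases n2 <;> (try (exfalso; omega)) <;>
    interval_cases n3 <;> (try (exfalso; omega)) <;>
    interval_cases n4 <;> (try (exfalso; omega)) <;>
    interval_cases n5 <;> (try (exfalso; omega)) <;>
    interval_cases n6 <;>
    first
    | omega
    | exact leafLowWeight_of_isHoffman (by decide)
    | exact leafCert_w9_211113
    | exact leafCert_w9_211122
    | exact leafCert_w9_211131
    | exact leafCert_w9_211212
    | exact leafCert_w9_211221
    | exact leafCert_w9_211311
    | exact leafCert_w9_212112
    | exact leafCert_w9_212121
    | exact leafCert_w9_212211
    | exact leafCert_w9_213111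
    | exact leafCert_w9_221112
    | exact leafCert_w9_221121
    | exact leafCert_w9_221211
    | exact leafCert_w9_222111
    | exact leafCert_w9_231111
    | exact leafCert_w9_311112
    | exact leafCert_w9_311121
    | exact leafCert_w9_311211
    | exact leafCert_w9_312111
    | exact leafCert_w9_321111
    | exact leafCert_w9_411111

/-- The weight-`9` leaf in depth `7`: dispatch of the admissible indices `[n1, n2, n3, n4, n5, n6,
n7]` of weight `9` to their certificates (`interval_cases` with `omega` pruning). [cite:
IharaKanekoZagier2006, §2] -/
theorem leafW9_depth7 (n1 : ℕ) (n2 : ℕ) (n3 : ℕ) (n4 : ℕ) (n5 : ℕ) (n6 : ℕ) (n7 : ℕ) (hn1 : 2 ≤ n1)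
    (hn2 : 1 ≤ n2) (hn3 : 1 ≤ n3) (hn4 : 1 ≤ n4) (hn5 : 1 ≤ n5) (hn6 : 1 ≤ n6) (hn7 : 1 ≤ n7) (hw :
    n1 + (n2 + (n3 + (n4 + (n5 + (n6 + n7))))) = 9) :
    ∃ b : List ℕ →₀ ℚ, (∀ t ∈ b.support, MZV.IsHoffman t ∧ MZV.weight t = MZV.weight [n1, n2, n3,
      n4, n5, n6, n7]) ∧ ∀ (R : Type) [CommRing R] [Algebra ℚ R] [IsReduced R] (φ : NCSeries Bool
      R), NCSeries.IsGroupLike φ → NCSeries.DrinfeldPentagon φ → φ (MZV.binaryWord [n1, n2, n3, n4,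
      n5, n6, n7]) = b.sum (fun t q => q • φ (MZV.binaryWord t)) := by
  have hn1' : n1 ≤ 3 := by omega
  have hn2' : n2 ≤ 2 := by omega
  have hn3' : n3 ≤ 2 := by omega
  have hn4' : n4 ≤ 2 := by omega
  have hn5' : n5 ≤ 2 := by omega
  have hn6' : n6 ≤ 2 := by omega
  have hn7' : n7 ≤ 2 := by omega
  interval_cases n1 <;>
    interval_cases n2 <;> (try (exfalso; omega)) <;>
    interval_cases n3 <;> (try (exfalso; omega)) <;>
    interval_cases n4 <;> (try (exfalso; omega)) <;>
    interval_cases n5 <;> (try (exfalso; omega)) <;>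
    interval_cases n6 <;> (try (exfalso; omega)) <;>
    interval_cases n7 <;>
    first
    | omega
    | exact leafLowWeight_of_isHoffman (by decide)
    | exact leafCert_w9_2111112
    | exact leafCert_w9_2111121
    | exact leafCert_w9_2111211
    | exact leafCert_w9_2112111
    | exact leafCert_w9_2121111
    | exact leafCert_w9_2211111
    | exact leafCert_w9_3111111

/-- The weight-`9` leaf in depth `8`: dispatch of the admissible indices `[n1, n2, n3, n4, n5, n6,
n7, n8]` of weight `9` to their certificates (`interval_cases` with `omega` pruning). [cite:
IharaKanekoZagier2006, §2] -/
theorem leafW9_depth8 (n1 : ℕ) (n2 : ℕ) (n3 : ℕ) (n4 : ℕ) (n5 : ℕ) (n6 : ℕ) (n7 : ℕ) (n8 : ℕ) (hn1 :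
    2 ≤ n1) (hn2 : 1 ≤ n2) (hn3 : 1 ≤ n3) (hn4 : 1 ≤ n4) (hn5 : 1 ≤ n5) (hn6 : 1 ≤ n6) (hn7 : 1 ≤
    n7) (hn8 : 1 ≤ n8) (hw : n1 + (n2 + (n3 + (n4 + (n5 + (n6 + (n7 + n8)))))) = 9) :
    ∃ b : List ℕ →₀ ℚ, (∀ t ∈ b.support, MZV.IsHoffman t ∧ MZV.weight t = MZV.weight [n1, n2, n3,
      n4, n5, n6, n7, n8]) ∧ ∀ (R : Type) [CommRing R] [Algebra ℚ R] [IsReduced R] (φ : NCSeries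
      Bool R), NCSeries.IsGroupLike φ → NCSeries.DrinfeldPentagon φ → φ (MZV.binaryWord [n1, n2, n3,
      n4, n5, n6, n7, n8]) = b.sum (fun t q => q • φ (MZV.binaryWord t)) := by
  obtain rfl : n1 = 2 := by omega
  obtain rfl : n2 = 1 := by omega
  obtain rfl : n3 = 1 := by omega
  obtain rfl : n4 = 1 := by omega
  obtain rfl : n5 = 1 := by omega
  obtain rfl : n6 = 1 := by omega
  obtain rfl : n7 = 1 := by omega
  obtain rfl : n8 = 1 := by omega
  exact leafCert_w9_21111111

/-- **Registered sub-goal `stub_w9Depth`** (crux stmt-KontsevichZagierPeriods-15058, line `Sketch`,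
helper file of `stub_leafWeightNine`): the depth-one case of the weight-`9` leaf in closed form.
[cite: IharaKanekoZagier2006, §2] -/
theorem stub_w9Depth : ∀ n1 : ℕ, 2 ≤ n1 → n1 = 9 →
    ∃ b : List ℕ →₀ ℚ, (∀ t ∈ b.support, MZV.IsHoffman t ∧ MZV.weight t = MZV.weight [n1]) ∧ ∀ (R :
      Type) [CommRing R] [Algebra ℚ R] [IsReduced R] (φ : NCSeries Bool R), NCSeries.IsGroupLike φ →
      NCSeries.DrinfeldPentagon φ → φ (MZV.binaryWord [n1]) = b.sum (fun t q => q • φ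
      (MZV.binaryWord t)) :=
  fun n1 h1 hw => leafW9_depth1 n1 h1 hw

end Summit.KontsevichZagierPeriods.FurushoPentagon.KernelModuloPeriodConjecture
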